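import Literature.NumberTheory.EllipticCurves.HeegnerPointsShimuraReduction
import Literature.NumberTheory.EllipticCurves.HeegnerPointsTrustBaseProofs
import HarnessLib

/-!
# `exists_isHeegnerPoint`: the trust base after the complex-multiplication half is proved
# (per datum, per curve, and globally — modulo the `ℚ`-rationality of `φ` at the CM points)

Topic `NumberTheory/EllipticCurves`; a proofs-only companion (theorems only: no definitions, no named
facts) of `HeegnerPoints.lean` (the named fact
`Literature.NumberTheory.EllipticCurves.exists_isHeegnerPoint W K`: for `W/ℚ` globally minimal of
conductor `N_E` and `K` imaginary quadratic with the Heegner hypothesis, some `P ∈ E(K)` is a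
Heegner point of level `N_E`; Gross–Zagier 1986, I.§4; Gross 1991, §1; Darmon 2004, §3.7), third of
the trust-base certificates `HeegnerPointsTrustBaseProofs` (modulo the CM fact
`heegnerPoints_galoisConj`) and `HeegnerPointsTrustBaseCMProofs` (modulo Darmon's Thms. 3.6–3.7 over
`H_K`).  Since then the tree PROVED the complex-multiplication half of Darmon's Thms. 3.5–3.7
(`HeegnerPointsShimuraReduction.lean`: `exists_point_of_isAutEquivariantOnHeegner`, Thm. 3.6, and
`heegnerPoints_perm_of_isAutEquivariantOnHeegner`, Thm. 3.7, from Cox's Thm. 10.23 via `Aut(ℂ)`,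
the level-`N` transport `HeegnerPointsLevelTransport.lean` and `irreducible_classPolynomial_holds`),
leaving as the only complex-multiplication-side input the predicate
`ModularParametrizationData.IsAutEquivariantOnHeegner Dt D` — "`φ = Φ_N : X₀(N) → E` is defined over
`ℚ`" read at the Heegner points (Darmon 2004, proof of Thm. 3.6; Knapp 1993, Thm. 11.74) — a
predicate with binders, not a named fact.  This file records what that leaves of the fact:

* `exists_map_eq_heegnerPointComplex_of_isAutEquivariantOnHeegner` — **leaf 4 per datum**: for ONE
  datum `Dt` with `Dt.IsAutEquivariantOnHeegner d_K`, every Heegner datum `H` and embedding `ι`, the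
  traced point `∑_{Q ∈ H.reps} φ(τ_Q)` is the image of a point of `E(K)` ("`P_K = Trace_{H/K} P_1 ∈
  E(K)`", Darmon §3.7) — the tree's `heegnerPointComplex_mem_range_map_of_isAutEquivariantOnHeegner`
  asks the predicate of *every* datum at level `N`; here only of the datum used.
* `exists_isHeegnerPoint_of_exists_isAutEquivariantOnHeegner` — **the fact for `W, K` from a single
  per-curve hypothesis**: under the binders of the fact, *some* datum `Dt` at level `N_E` is
  `Aut(ℂ/K)`-equivariant on the Heegner points of discriminant `d_K`.  This is the printed input in
  the form it is used: "let `Φ_N : X₀(N) → E` be a modular parametrisation defined over `ℚ`"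
  (BCDT 2001, Thm. A in form (1): a non-constant `ℚ`-morphism `X₀(N) → E`; Darmon 2004, Thm. 2.13 and
  §3.7), with `Φ_N^*ω = c·2πi f(τ)dτ`; nothing global (`nonempty_modularParametrizationData` for all
  curves) is assumed.
* `nonempty_modularParametrizationData_of_exists_isHeegnerPoint` (converse, trivially: a Heegner
  point carries its datum) and `exists_isHeegnerPoint_iff_of_isAutEquivariantOnHeegner` — **per curve,
  modulo the predicate for the data of `W` at level `N_E`, the fact `exists_isHeegnerPoint W K` is
  equivalent to the existence of a modular parametrisation datum of `W` at level `N_E` whenever `K`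
  is a Heegner field for `W`** (i.e. to the modularity of `W` in the tree's analytic form).
* `forall_exists_isHeegnerPoint_of_modularity_of_maninConstant_of_isAutEquivariantOnHeegner`,
  `forall_exists_isHeegnerPoint_iff_of_isAutEquivariantOnHeegner`,
  `forall_exists_isHeegnerPoint_iff_nonempty_modularParametrizationData_of_isAutEquivariantOnHeegner`,
  `forall_exists_isHeegnerPoint_of_existsUnique_isNewformOf_of_maninConstant_of_isAutEquivariantOnHeegner`
  — the global forms `∀ W K` consumed by the BSD rank-`≤ 1` assembly
  (`HeegnerPointReflectionHolds.rank_eq_analyticRank_of_analyticRank_le_one_of_modularity''`, whose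
  `hHP` is `∀ W K, exists_isHeegnerPoint W K` next to `hmod : existsUnique_isNewformOf`): modulo the
  predicate at every level, `(∀ W K, exists_isHeegnerPoint W K) ↔ exists_isNewformOf ∧
  IsNewformOf.exists_maninConstant_ne_zero ↔ nonempty_modularParametrizationData`, the direction `→`
  being unconditional (`HeegnerPointsTrustBaseProofs`: the fact at all `W, K` implies the Modularity
  theorem, by Dirichlet's theorem supplying Heegner fields).

**Current trust base of `exists_isHeegnerPoint` (2026-08-15).**  { `ModularForms.exists_isNewformOf`
(the Modularity theorem, BCDT 2001 Thm. A (2); NECESSARY), `IsNewformOf.exists_maninConstant_ne_zero`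
(rational Manin constant; necessary jointly with the former), and the predicate
`IsAutEquivariantOnHeegner` for the data at level `N_E` and discriminant `d_K` (the `ℚ`-rationality
of the Eichler–Shimura parametrisation at the CM points; Shimura 1971, Thm. 7.14 with §6.7–6.8) }.
Everything else on the DAG of the fact — Heegner condition, Heegner data, CM theory of the singular
moduli, Shimura reciprocity in transport form, Galois descent of the trace — is a theorem of the tree.

## References

* B. H. Gross, D. B. Zagier, *Heegner points and derivatives of `L`-series*, Invent. Math. 84
  (1986), 225–320, I.§4. [GrossZagier1986]
* B. H. Gross, *Kolyvagin's work on modular elliptic curves*, LMS Lecture Note Ser. 153 (1991),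
  235–256, §1 (pp. 235–236). [GrossLMS1991]
* H. Darmon, *Rational points on modular elliptic curves*, CBMS 101, AMS 2004, Thm. 3.6 and its
  proof (PDF p. 43), Thm. 3.7 (PDF p. 44), §3.7 (PDF p. 49). [Darmon2004]
* C. Breuil, B. Conrad, F. Diamond, R. Taylor, *On the modularity of elliptic curves over `ℚ`: wild
  3-adic exercises*, J. Amer. Math. Soc. 14 (2001), 843–939, Theorem A. [BCDTJAMS2001]
* A. W. Knapp, *Elliptic Curves*, Princeton 1993, Thm. 11.74 and Remarks. [Knapp1993]
-/

noncomputable section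

open scoped Classical

namespace Literature.NumberTheory.EllipticCurves

open Literature.NumberTheory.EllipticCurves.ModularForms NumberField

universe u

/-! ### Leaf 4 per datum -/

section PerDatum

variable {N : ℕ} [NeZero N] {W : WeierstrassCurve ℚ} {K : Type u} [Field K] [NumberField K]

/-- **Leaf 4 for a single datum** ("`P_K = Trace_{H_1/K}(P_1) ∈ E(K)`", Darmon 2004, §3.7): if the
parametrisation `φ` of the datum `Dt` at level `N` is `Aut(ℂ/K)`-equivariant along level-`N` transport
of the Heegner points of discriminant `d_K` (`Dt.IsAutEquivariantOnHeegner d_K`: "`X₀(N) → E` is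
defined over `ℚ`", proof of Darmon's Thm. 3.6), then for every Heegner datum `H` of discriminant `d_K`
and every embedding `ι : K → ℂ` the traced Heegner point `∑_{Q ∈ H.reps} φ(τ_Q) ∈ E(ℂ)` is the image
under `ι` of a point of `E(K)`.  Proof: the points `φ(τ_Q)` come from `E(H_K)`, `H_K ⊂ ℂ` the field
of singular moduli (`exists_point_of_isAutEquivariantOnHeegner`, Thm. 3.6), finite Galois over `K`
(`finiteDimensional_and_isGalois_singularModuliField` with `irreducible_classPolynomial_holds`), and
are permuted by `Gal(H_K/K)` (`heegnerPoints_perm_of_isAutEquivariantOnHeegner`, Thm. 3.7); the sum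
descends to `E(K)` (`exists_map_eq_sum_of_galois_perm`).  Compared with the tree's
`heegnerPointComplex_mem_range_map_of_isAutEquivariantOnHeegner` the predicate is asked of `Dt` only.
[cite: Darmon2004, §3.7 (PDF p. 49)] -/
theorem exists_map_eq_heegnerPointComplex_of_isAutEquivariantOnHeegner [W.IsElliptic]
    (hK : IsImaginaryQuadratic K) (hH : SatisfiesHeegnerHypothesis N K)
    (Dt : ModularParametrizationData W N) (hφ : Dt.IsAutEquivariantOnHeegner (NumberField.discr K))
    (H : HeegnerDatum N (NumberField.discr K)) (ι : K →+* ℂ) :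
    ∃ P : (W.baseChange K).toAffine.Point,
      WeierstrassCurve.Affine.Point.map ι.toRatAlgHom P = heegnerPointComplex Dt H := by
  obtain ⟨-, hgal⟩ :=
    finiteDimensional_and_isGalois_singularModuliField irreducible_classPolynomial_holds hK ι
  haveI := numberField_singularModuliField irreducible_classPolynomial_holds hK ι
  choose P hP using fun q : H.reps ↦ exists_point_of_isAutEquivariantOnHeegner hK hH Dt hφ ι
    H.dvd_sq_sub (H.mem_heegnerForms q q.2).1 (H.mem_heegnerForms q q.2).2
  obtain ⟨P₀, hP₀⟩ := exists_map_eq_sum_of_galois_perm (k := K) W (singularModuliField K ι).subtype P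
    fun σ ↦ heegnerPoints_perm_of_isAutEquivariantOnHeegner hK hH Dt hφ H ι P hP σ
  refine ⟨P₀, ?_⟩
  rw [subtype_comp_algebraMap_singularModuliField ι] at hP₀
  rw [hP₀, heegnerPointComplex, ← Finset.sum_coe_sort H.reps fun Q ↦ Dt.φ (heegnerTau Q)]
  exact Fintype.sum_congr _ _ fun q ↦ hP q

end PerDatum

/-! ### The fact per curve: one datum, `ℚ`-rational at the Heegner points of `K` -/

section PerCurve

variable {W : WeierstrassCurve ℚ} {K : Type u} [Field K] [NumberField K]

/-- **`exists_isHeegnerPoint W K` from a single per-curve hypothesis.**  If — for `W` elliptic and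
globally minimal with `N_E ≠ 0`, and `K` imaginary quadratic satisfying the Heegner hypothesis for
`N_E` — there is SOME modular parametrisation datum `Dt` of `W` at level `N_E` whose `φ` is
`Aut(ℂ/K)`-equivariant on the Heegner points of discriminant `d_K` ("let `Φ_N : X₀(N) → E` be a
modular parametrisation defined over `ℚ`": the Modularity theorem in form (1) of BCDT's Theorem A
together with `Φ_N^* ω_E = c · 2πi f(τ)dτ`, read at the CM points), then some `P ∈ E(K)` is a Heegner
point of level `N_E`: `y_K = Tr_{H/K} φ(x_1) ∈ E(K)` (Gross 1991, §1).  The Heegner condition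
(`exists_dvd_sq_sub_discr_holds`), the Heegner data (`nonempty_heegnerDatum_holds`) and leaf 4 for the
datum (`exists_map_eq_heegnerPointComplex_of_isAutEquivariantOnHeegner`) are theorems of the tree.
[cite: GrossLMS1991, §1 (pp. 235–236)] -/
theorem exists_isHeegnerPoint_of_exists_isAutEquivariantOnHeegner
    (h : ∀ [W.IsElliptic] [W.IsGloballyMinimal] [NeZero (W.conductorNorm ℤ)],
      IsImaginaryQuadratic K → SatisfiesHeegnerHypothesis (W.conductorNorm ℤ) K →
      ∃ Dt : ModularParametrizationData W (W.conductorNorm ℤ),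
        Dt.IsAutEquivariantOnHeegner (NumberField.discr K)) :
    exists_isHeegnerPoint W K := by
  intro _ _ _ hK hH
  obtain ⟨Dt, hφ⟩ := h hK hH
  obtain ⟨β, hβ⟩ := exists_dvd_sq_sub_discr_holds (W.conductorNorm ℤ) K hK hH
  obtain ⟨H, -⟩ := nonempty_heegnerDatum_holds (W.conductorNorm ℤ) K hK hβ
  obtain ⟨ι⟩ : Nonempty (K →+* ℂ) := inferInstance
  obtain ⟨P, hP⟩ := exists_map_eq_heegnerPointComplex_of_isAutEquivariantOnHeegner hK hH Dt hφ H ι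
  exact ⟨P, Dt, H, ι, hP⟩

/-- **Converse (a Heegner point carries its datum).**  If `exists_isHeegnerPoint W K` holds then, under
its binders, `W` has a modular parametrisation datum at level `N_E`: `IsHeegnerPoint` packages one.
[folklore] -/
theorem nonempty_modularParametrizationData_of_exists_isHeegnerPoint (h : exists_isHeegnerPoint W K)
    [W.IsElliptic] [W.IsGloballyMinimal] [NeZero (W.conductorNorm ℤ)] (hK : IsImaginaryQuadratic K)
    (hH : SatisfiesHeegnerHypothesis (W.conductorNorm ℤ) K) :
    Nonempty (ModularParametrizationData W (W.conductorNorm ℤ)) := by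
  obtain ⟨_P, Dt, _⟩ := h hK hH
  exact ⟨Dt⟩

/-- **Per curve, modulo the `ℚ`-rationality of `φ` at the Heegner points, the fact is the modularity
of `W`.**  Granted `IsAutEquivariantOnHeegner d_K` for the data of `W` at level `N_E` (proof of
Darmon's Thm. 3.6: "`X₀(N) → E` is defined over `ℚ`"), `exists_isHeegnerPoint W K` is equivalent to:
under the binders of the fact (in particular `K` a Heegner field for `N_E`), `W` admits a modular
parametrisation datum at level `N_E`. [cite: Darmon2004, Thm. 3.6 and §3.7] -/
theorem exists_isHeegnerPoint_iff_of_isAutEquivariantOnHeegner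
    (hφ : ∀ [W.IsElliptic] [NeZero (W.conductorNorm ℤ)]
      (Dt : ModularParametrizationData W (W.conductorNorm ℤ)),
      IsImaginaryQuadratic K → SatisfiesHeegnerHypothesis (W.conductorNorm ℤ) K →
      Dt.IsAutEquivariantOnHeegner (NumberField.discr K)) :
    exists_isHeegnerPoint W K ↔
      ∀ [W.IsElliptic] [W.IsGloballyMinimal] [NeZero (W.conductorNorm ℤ)],
        IsImaginaryQuadratic K → SatisfiesHeegnerHypothesis (W.conductorNorm ℤ) K →
        Nonempty (ModularParametrizationData W (W.conductorNorm ℤ)) := by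
  refine ⟨fun h _ _ _ hK hH ↦ nonempty_modularParametrizationData_of_exists_isHeegnerPoint h hK hH,
    fun h ↦ exists_isHeegnerPoint_of_exists_isAutEquivariantOnHeegner fun hK hH ↦ ?_⟩
  obtain ⟨Dt⟩ := h hK hH
  exact ⟨Dt, hφ Dt hK hH⟩

end PerCurve

/-! ### The global forms `∀ W K` (for the BSD rank-`≤ 1` assembly) -/

section Global

/-- **`∀ W K, exists_isHeegnerPoint W K` from the Modularity theorem, the rational Manin constant and
the `ℚ`-rationality of `φ` at the Heegner points** — the hypothesis `hHP` of the BSD rank-`≤ 1`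
assembly (`rank_eq_analyticRank_of_analyticRank_le_one_of_modularity''`) from the current trust base:
`exists_isNewformOf` (BCDT 2001, Thm. A (2)), `IsNewformOf.exists_maninConstant_ne_zero`, and the
predicate `IsAutEquivariantOnHeegner d_K` for the data at every level and every Heegner field (proof
of Darmon's Thm. 3.6).  The complex-multiplication half (Darmon Thms. 3.5–3.7) and the descent of the
trace are theorems of the tree (`exists_isHeegnerPoint_of_modularity_of_isAutEquivariantOnHeegner`).
[cite: Darmon2004, Thm. 3.6 and §3.7] -/
theorem forall_exists_isHeegnerPoint_of_modularity_of_maninConstant_of_isAutEquivariantOnHeegner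
    (h₁ : exists_isNewformOf) (ha : IsNewformOf.exists_maninConstant_ne_zero)
    (hφ : ∀ (N : ℕ) [NeZero N] (W : WeierstrassCurve ℚ) [W.IsElliptic] (K : Type) [Field K]
      [NumberField K] (Dt : ModularParametrizationData W N), IsImaginaryQuadratic K →
      SatisfiesHeegnerHypothesis N K → Dt.IsAutEquivariantOnHeegner (NumberField.discr K)) :
    ∀ (W : WeierstrassCurve ℚ) (K : Type) [Field K] [NumberField K], exists_isHeegnerPoint W K := by
  intro W K _ _
  refine (exists_isHeegnerPoint_iff_of_isAutEquivariantOnHeegner fun Dt hK hH ↦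
    hφ _ W K Dt hK hH).mpr fun hK hH ↦ ?_
  exact nonempty_modularParametrizationData_of_exists_isNewformOf h₁ ha W

/-- The same with the Modularity theorem in the form `existsUnique_isNewformOf` used by the BSD
assemblies (`hmod`; equivalent to `exists_isNewformOf` by strong multiplicity one,
`exists_isNewformOf_of_existsUnique`). [cite: Darmon2004, Thm. 3.6 and §3.7] -/
theorem forall_exists_isHeegnerPoint_of_existsUnique_isNewformOf_of_maninConstant_of_isAutEquivariantOnHeegner
    (hmod : existsUnique_isNewformOf) (ha : IsNewformOf.exists_maninConstant_ne_zero)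
    (hφ : ∀ (N : ℕ) [NeZero N] (W : WeierstrassCurve ℚ) [W.IsElliptic] (K : Type) [Field K]
      [NumberField K] (Dt : ModularParametrizationData W N), IsImaginaryQuadratic K →
      SatisfiesHeegnerHypothesis N K → Dt.IsAutEquivariantOnHeegner (NumberField.discr K)) :
    ∀ (W : WeierstrassCurve ℚ) (K : Type) [Field K] [NumberField K], exists_isHeegnerPoint W K :=
  forall_exists_isHeegnerPoint_of_modularity_of_maninConstant_of_isAutEquivariantOnHeegner
    (exists_isNewformOf_of_existsUnique hmod) ha hφ

/-- **Modulo the `ℚ`-rationality of `φ` at the Heegner points, `∀ W K, exists_isHeegnerPoint W K` is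
equivalent to the Modularity leaf with rational Manin constant**: `→` unconditionally
(`nonempty_modularParametrizationData_of_forall_exists_isHeegnerPoint`: Heegner fields exist for every
level by Dirichlet's theorem, and a Heegner point carries its datum;
`nonempty_modularParametrizationData_iff`), `←` by the previous theorem. [folklore] -/
theorem forall_exists_isHeegnerPoint_iff_of_isAutEquivariantOnHeegner
    (hφ : ∀ (N : ℕ) [NeZero N] (W : WeierstrassCurve ℚ) [W.IsElliptic] (K : Type) [Field K]
      [NumberField K] (Dt : ModularParametrizationData W N), IsImaginaryQuadratic K →
      SatisfiesHeegnerHypothesis N K → Dt.IsAutEquivariantOnHeegner (NumberField.discr K)) :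
    (∀ (W : WeierstrassCurve ℚ) (K : Type) [Field K] [NumberField K], exists_isHeegnerPoint W K) ↔
      exists_isNewformOf ∧ IsNewformOf.exists_maninConstant_ne_zero :=
  ⟨fun h ↦ nonempty_modularParametrizationData_iff.mp
      (nonempty_modularParametrizationData_of_forall_exists_isHeegnerPoint h),
    fun h ↦ forall_exists_isHeegnerPoint_of_modularity_of_maninConstant_of_isAutEquivariantOnHeegner
      h.1 h.2 hφ⟩

/-- The same equivalence with the Modularity leaf `nonempty_modularParametrizationData` on the right.
[folklore] -/
theorem forall_exists_isHeegnerPoint_iff_nonempty_modularParametrizationData_of_isAutEquivariantOnHeegner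
    (hφ : ∀ (N : ℕ) [NeZero N] (W : WeierstrassCurve ℚ) [W.IsElliptic] (K : Type) [Field K]
      [NumberField K] (Dt : ModularParametrizationData W N), IsImaginaryQuadratic K →
      SatisfiesHeegnerHypothesis N K → Dt.IsAutEquivariantOnHeegner (NumberField.discr K)) :
    (∀ (W : WeierstrassCurve ℚ) (K : Type) [Field K] [NumberField K], exists_isHeegnerPoint W K) ↔
      nonempty_modularParametrizationData := by
  rw [forall_exists_isHeegnerPoint_iff_of_isAutEquivariantOnHeegner hφ,
    nonempty_modularParametrizationData_iff]

end Global

end Literature.NumberTheory.EllipticCurves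

end
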